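import Summits.AtomisticToContinuum.Crystallization.Theorems.GappedShellCensusCleanLimitsHaveWindowsVerticalPinning2

/-!
# Vertical pinning, part 3: the certified gain of shrinking a HIGH gap

Helper for the registered stub `stub_verticalPinning` (T4b-iv) of line `Sketch` of the crux
`GappedShellCensus.CleanLimitsHaveWindows` (stmt-AtomisticToContinuum-15932).

In-plane spacing `b ≥ 191/200` (the in-plane pinned window), so `b⁻⁶ ≤ 33/25`. A HIGH gap
(`Δ_g ≥ 17b/20`) forces all increments into `[4b/5, 13b/15]`. Shrinking the gap by `b/200` changes the
interaction of the layer pairs straddling it; with the per-site coefficients of part 2 the box sums over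
`[-4,4]²` are certified by `norm_num`:

* adjacent layers (offset registry, heights `[17b/20, 13b/15]`): `Σ ≥ −0.835` (`vp_box_high_one`);
* layers at distance two (either registry, heights `[33b/20, 26b/15]`): `Σ ≥ 0.428`;
* distance three (heights `[49b/20, 13b/5]`): `Σ ≥ 0.056`;

whence `(b⁻⁶)·γ_k ≤ Φ_δ(H) − Φ_δ(H − b/200)` with `1200·(γ₁, γ₂, γ₃) = (−0.835, 0.428, 0.056)` and
`γ₁ + 2γ₂ + 3γ₃ > 0` (`vp_high_one/two/three`); farther pairs never lose (`vp_shrink_nonneg`: the layer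
sums increase with the height beyond the potential minimum). First the layer-sum forms of the per-site bounds
of part 2: the box `[-4,4]²` site by site, the outside dropped (shrinking, `vp_layer_shrink`) or bounded by
the square-shell tail of `LayeredHull.cvx_lattice_tsum_le` (expanding, `vp_layer_expand`). [folklore]
-/

noncomputable section

namespace Summit.AtomisticToContinuum.Crystallization.Theorems.CleanHull

open scoped BigOperators
open Finset Literature.MathematicalPhysics.StatisticalMechanics

/-! ## Layer sums -/

/-- The layer interaction as the lattice sum of the terms `vpTerm`. [folklore] -/
theorem vp_layerInteraction_eq (b H : ℝ) (δ : ℤ) :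
    layerInteraction lennardJones b H δ 1 = ∑' p : ℤ × ℤ, vpTerm b (vpP δ p) H := by
  simp only [vpTerm, vpP]
  exact LayeredHull.cvx_layerInteraction_eq b H δ

/-- Summability of the layer terms (`b ∈ [47/50, 1]`, `δ ∈ {0,1}`, `H > 0`). [folklore] -/
theorem vp_summable (b : ℝ) (hb : 47 / 50 ≤ b) (δ : ℤ) (hδ : δ = 0 ∨ δ = 1) (H : ℝ) (hH : 0 < H) :
    Summable fun p : ℤ × ℤ => vpTerm b (vpP δ p) H := by
  simp only [vpTerm, vpP]
  exact LayeredHull.cvx_summable_layerTerm b hb δ hδ H hH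

/-- Sites outside the box `[-4, 4]²` have `P ≥ 49/3`. [folklore] -/
theorem vpP_ge_of_not_mem_box (δ : ℤ) (hδ : δ = 0 ∨ δ = 1) (p : ℤ × ℤ)
    (hp : p ∉ Icc (-((4 : ℕ) : ℤ)) (4 : ℕ) ×ˢ Icc (-((4 : ℕ) : ℤ)) (4 : ℕ)) : 49 / 3 ≤ vpP δ p := by
  rw [LayeredHull.cvx_mem_box] at hp
  have hmax : (5 : ℤ) ≤ max |p.1| |p.2| := by
    rcases not_and_or.1 hp with h | h
    · exact le_trans (by omega) (le_max_left _ _)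
    · exact le_trans (by omega) (le_max_right _ _)
  have hshell := LayeredHull.cvx_P_ge_shell δ hδ p (by omega)
  have h5 : (5 : ℝ) ≤ ((max |p.1| |p.2| : ℤ) : ℝ) := by exact_mod_cast hmax
  unfold vpP
  nlinarith

/-- **Layer bound, shrinking.** For `b ∈ [47/50, 1]`, `b⁻⁶ ≤ β`, `δ ∈ {0,1}`, `0 < τ < x₁ ≤ x ≤ x₂`:
`(b⁻⁶/6)·τ·Σ_{[-4,4]²} vpCs ≤ Φ_δ(xb) − Φ_δ((x−τ)b)` (the sites outside the box are dropped: there the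
term increases with the height). [folklore] -/
theorem vp_layer_shrink (b β x₁ x₂ τ x : ℝ) (δ : ℤ) (hδ : δ = 0 ∨ δ = 1) (hb : 47 / 50 ≤ b)
    (hβ : (b⁻¹) ^ 6 ≤ β) (hτ : 0 < τ) (hx₁ : τ < x₁) (h1 : x₁ ≤ x) (h2 : x ≤ x₂) :
    (b⁻¹) ^ 6 / 6 * (τ * ∑ p ∈ Icc (-((4 : ℕ) : ℤ)) (4 : ℕ) ×ˢ Icc (-((4 : ℕ) : ℤ)) (4 : ℕ),
        vpCs β (vpP δ p) x₁ x₂ τ) ≤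
      layerInteraction lennardJones b (x * b) δ 1 - layerInteraction lennardJones b ((x - τ) * b) δ 1 := by
  have hb0 : 0 < b := by linarith
  have hxτ : 0 < x - τ := by linarith
  have hx0 : 0 < x := by linarith
  have hs1 := vp_summable b hb δ hδ (x * b) (by positivity)
  have hs2 := vp_summable b hb δ hδ ((x - τ) * b) (by positivity)
  rw [vp_layerInteraction_eq, vp_layerInteraction_eq, ← hs1.tsum_sub hs2, Finset.mul_sum, Finset.mul_sum]
  refine le_trans (Finset.sum_le_sum fun p _ =>
    vp_site_shrink b β (vpP δ p) x₁ x₂ τ x hb0 hβ (vpP_nonneg δ p) hτ hx₁ h1 h2) ?_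
  refine (hs1.sub hs2).sum_le_tsum _ fun p hp => ?_
  have hP := vpP_ge_of_not_mem_box δ hδ p hp
  refine sub_nonneg.2 (vp_term_mono b (vpP δ p) (x * b) ((x - τ) * b) (by positivity)
    (by nlinarith) ?_)
  have hb2 : (47 / 50 : ℝ) ^ 2 ≤ b ^ 2 := pow_le_pow_left₀ (by norm_num) hb 2
  nlinarith [sq_nonneg ((x - τ) * b)]

/-- **Layer bound, expanding.** For `b ∈ [47/50, 1]`, `0 ≤ β ≤ b⁻⁶`, `δ ∈ {0,1}`, `0 < τ`,
`0 < x₁ ≤ x ≤ x₂`: `(b⁻⁶/6)·(τ·Σ_{[-4,4]²} vpCe − τ(2x₂+τ)·3·tail) ≤ Φ_δ(xb) − Φ_δ((x+τ)b)`, the sites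
outside the box bounded by the square-shell tail of `LayeredHull.cvx_lattice_tsum_le`. [folklore] -/
theorem vp_layer_expand (b β x₁ x₂ τ x : ℝ) (δ : ℤ) (hδ : δ = 0 ∨ δ = 1) (hb : 47 / 50 ≤ b)
    (hβ0 : 0 ≤ β) (hβ : β ≤ (b⁻¹) ^ 6) (hτ : 0 < τ) (hx₁ : 0 < x₁) (h1 : x₁ ≤ x) (h2 : x ≤ x₂) :
    (b⁻¹) ^ 6 / 6 * (τ * ∑ p ∈ Icc (-((4 : ℕ) : ℤ)) (4 : ℕ) ×ˢ Icc (-((4 : ℕ) : ℤ)) (4 : ℕ),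
        vpCe β (vpP δ p) x₁ x₂ τ -
      τ * (2 * x₂ + τ) * (3 * (32 * (((4 : ℕ) : ℝ) + 1) / (3 * (6 * ((4 : ℕ) : ℝ) + 1)) * 1 *
        ((3 / 4 * ((((4 : ℕ) : ℝ)) - 1 / 3) ^ 2 + x₁ ^ 2)⁻¹) ^ 3))) ≤
      layerInteraction lennardJones b (x * b) δ 1 - layerInteraction lennardJones b ((x + τ) * b) δ 1 := by
  classical
  have hb0 : 0 < b := by linarith
  have hx0 : 0 < x := by linarith
  have hx₂ : 0 < x₂ := by linarith
  have hs1 := vp_summable b hb δ hδ (x * b) (by positivity)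
  have hs2 := vp_summable b hb δ hδ ((x + τ) * b) (by positivity)
  set B : Finset (ℤ × ℤ) := Icc (-((4 : ℕ) : ℤ)) (4 : ℕ) ×ˢ Icc (-((4 : ℕ) : ℤ)) (4 : ℕ) with hB
  set F : ℤ × ℤ → ℝ := fun p => vpTerm b (vpP δ p) (x * b) - vpTerm b (vpP δ p) ((x + τ) * b) with hF
  -- the tail majorant
  set G : ℤ × ℤ → ℝ := fun p => if p ∈ B then 0 else ((vpP δ p + x₁ ^ 2)⁻¹) ^ 4 with hG
  have hG0 : ∀ p, 0 ≤ G p := fun p => by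
    simp only [hG]; split_ifs
    · exact le_rfl
    · have := vpP_nonneg δ p; positivity
  have hT : 0 < x₁ ^ 2 := by positivity
  obtain ⟨hGs, hGle⟩ := LayeredHull.cvx_lattice_tsum_le (F := G) hG0 (N := 4) (n := 3) le_add_self
    (by norm_num) zero_le_one hT (by
      intro p hp
      simp only [hG]
      split_ifs with hpB
      · positivity
      · have hshell := LayeredHull.cvx_P_ge_shell δ hδ p (by omega)
        rw [one_mul]
        refine pow_le_pow_left₀ (by have := vpP_nonneg δ p; positivity) (inv_anti₀ (by positivity) ?_) 4
        unfold vpP; linarith)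
  have hGbox : ∑ p ∈ Icc (-((4 : ℕ) : ℤ)) (4 : ℕ) ×ˢ Icc (-((4 : ℕ) : ℤ)) (4 : ℕ), G p = 0 :=
    Finset.sum_eq_zero fun p hp => by simp only [hG]; rw [if_pos hp]
  rw [hGbox, zero_add] at hGle
  -- the lower-bound family
  set c : ℝ := (b⁻¹) ^ 6 / 6 * (τ * (2 * x₂ + τ) * 3) with hc
  have hc0 : 0 ≤ c := by positivity
  set e : ℤ × ℤ → ℝ := fun p => (if p ∈ B then F p else 0) - c * G p with he
  have heF : ∀ p, e p ≤ F p := by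
    intro p
    simp only [he, hG]
    split_ifs with hpB
    · simp
    · rw [zero_sub, hc, hF]
      have := vp_site_expand_crude b (vpP δ p) x₁ x₂ τ x hb0 (vpP_nonneg δ p) hτ hx₁ h1 h2
      refine le_trans (le_of_eq ?_) this
      ring
  have hind : Summable fun p => if p ∈ B then F p else 0 :=
    summable_of_ne_finset_zero (s := B) fun p hp => if_neg hp
  have hes : Summable e := hind.sub (hGs.mul_left c)
  rw [vp_layerInteraction_eq, vp_layerInteraction_eq, ← hs1.tsum_sub hs2]
  refine le_trans ?_ (hes.tsum_le_tsum heF (hs1.sub hs2))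
  rw [he, hind.tsum_sub (hGs.mul_left c), tsum_mul_left,
    tsum_eq_sum (s := B) (fun p hp => if_neg hp), Finset.sum_congr rfl (fun p hp => if_pos hp)]
  -- compare
  have hbox : (b⁻¹) ^ 6 / 6 * (τ * ∑ p ∈ B, vpCe β (vpP δ p) x₁ x₂ τ) ≤ ∑ p ∈ B, F p := by
    rw [Finset.mul_sum, Finset.mul_sum]
    exact Finset.sum_le_sum fun p _ =>
      vp_site_expand b β (vpP δ p) x₁ x₂ τ x hb0 hβ0 hβ (vpP_nonneg δ p) hτ hx₁ h1 h2
  have htail := mul_le_mul_of_nonneg_left hGle hc0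
  rw [mul_sub]
  have e3 : (b⁻¹) ^ 6 / 6 * (τ * (2 * x₂ + τ) * (3 * (32 * (((4 : ℕ) : ℝ) + 1) / (3 * (6 * ((4 : ℕ) : ℝ) + 1)) * 1 *
        ((3 / 4 * ((((4 : ℕ) : ℝ)) - 1 / 3) ^ 2 + x₁ ^ 2)⁻¹) ^ 3))) =
      c * (32 * (((4 : ℕ) : ℝ) + 1) / (3 * (6 * ((4 : ℕ) : ℝ) + 1)) * 1 *
        ((3 / 4 * ((((4 : ℕ) : ℝ)) - 1 / 3) ^ 2 + x₁ ^ 2)⁻¹) ^ 3) := by rw [hc]; ring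
  rw [e3]
  push_cast at htail ⊢
  linarith


/-! ## The four box sums -/

/-- Box sum, adjacent layers (offset registry), heights `x ∈ [17/20, 13/15]`. [folklore] -/
theorem vp_box_high_one :
    -(835 / 1000) ≤ ∑ p ∈ Icc (-((4 : ℕ) : ℤ)) (4 : ℕ) ×ˢ Icc (-((4 : ℕ) : ℤ)) (4 : ℕ),
      vpCs (33 / 25) (vpP 1 p) (17 / 20) (13 / 15) (1 / 200) := by
  rw [LayeredHull.cvx_sum_box_eq_sum_range]
  simp only [Finset.sum_range_succ, Finset.sum_range_zero, vpCs, vpP, vpG]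
  push_cast
  norm_num [min_def]

/-- Box sum, distance two, aligned registry, heights `x ∈ [33/20, 26/15]`. [folklore] -/
theorem vp_box_high_two_aligned :
    428 / 1000 ≤ ∑ p ∈ Icc (-((4 : ℕ) : ℤ)) (4 : ℕ) ×ˢ Icc (-((4 : ℕ) : ℤ)) (4 : ℕ),
      vpCs (33 / 25) (vpP 0 p) (33 / 20) (26 / 15) (1 / 200) := by
  rw [LayeredHull.cvx_sum_box_eq_sum_range]
  simp only [Finset.sum_range_succ, Finset.sum_range_zero, vpCs, vpP, vpG]
  push_cast
  norm_num [min_def]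

/-- Box sum, distance two, offset registry, heights `x ∈ [33/20, 26/15]`. [folklore] -/
theorem vp_box_high_two_offset :
    428 / 1000 ≤ ∑ p ∈ Icc (-((4 : ℕ) : ℤ)) (4 : ℕ) ×ˢ Icc (-((4 : ℕ) : ℤ)) (4 : ℕ),
      vpCs (33 / 25) (vpP 1 p) (33 / 20) (26 / 15) (1 / 200) := by
  rw [LayeredHull.cvx_sum_box_eq_sum_range]
  simp only [Finset.sum_range_succ, Finset.sum_range_zero, vpCs, vpP, vpG]
  push_cast
  norm_num [min_def]

/-- Box sum, distance three, aligned registry, heights `x ∈ [49/20, 13/5]`. [folklore] -/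
theorem vp_box_high_three_aligned :
    56 / 1000 ≤ ∑ p ∈ Icc (-((4 : ℕ) : ℤ)) (4 : ℕ) ×ˢ Icc (-((4 : ℕ) : ℤ)) (4 : ℕ),
      vpCs (33 / 25) (vpP 0 p) (49 / 20) (13 / 5) (1 / 200) := by
  rw [LayeredHull.cvx_sum_box_eq_sum_range]
  simp only [Finset.sum_range_succ, Finset.sum_range_zero, vpCs, vpP, vpG]
  push_cast
  norm_num [min_def]

/-- Box sum, distance three, offset registry, heights `x ∈ [49/20, 13/5]`. [folklore] -/
theorem vp_box_high_three_offset :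
    56 / 1000 ≤ ∑ p ∈ Icc (-((4 : ℕ) : ℤ)) (4 : ℕ) ×ˢ Icc (-((4 : ℕ) : ℤ)) (4 : ℕ),
      vpCs (33 / 25) (vpP 1 p) (49 / 20) (13 / 5) (1 / 200) := by
  rw [LayeredHull.cvx_sum_box_eq_sum_range]
  simp only [Finset.sum_range_succ, Finset.sum_range_zero, vpCs, vpP, vpG]
  push_cast
  norm_num [min_def]

/-! ## From box sums to layer sums -/

/-- `b ≥ 191/200` gives `b⁻⁶ ≤ 33/25`. [folklore] -/
theorem vp_beta_le (b : ℝ) (hb : 191 / 200 ≤ b) : (b⁻¹) ^ 6 ≤ 33 / 25 := by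
  have hb0 : 0 < b := by linarith
  have h1 : b⁻¹ ≤ 200 / 191 := by rw [inv_le_comm₀ hb0 (by norm_num)]; linarith
  calc (b⁻¹) ^ 6 ≤ (200 / 191 : ℝ) ^ 6 := pow_le_pow_left₀ (by positivity) h1 6
    _ ≤ 33 / 25 := by norm_num

/-- **Shrinking with a certified box sum.** If the box sum of `vpCs (33/25) (P_δ ·) x₁ x₂ (1/200)` is
`≥ S` (`δ ∈ {0,1}`) then for `b ≥ 191/200` and `H ∈ [x₁ b, x₂ b]` (`x₁ > 1/200`):
`b⁻⁶ · S/1200 ≤ Φ_δ(H) − Φ_δ(H − b/200)`. [folklore] -/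
theorem vp_shrink_of_box (δ : ℤ) (hδ : δ = 0 ∨ δ = 1) (x₁ x₂ S : ℝ) (hx₁ : 1 / 200 < x₁)
    (hS : S ≤ ∑ p ∈ Icc (-((4 : ℕ) : ℤ)) (4 : ℕ) ×ˢ Icc (-((4 : ℕ) : ℤ)) (4 : ℕ),
      vpCs (33 / 25) (vpP δ p) x₁ x₂ (1 / 200))
    (b : ℝ) (hb : 191 / 200 ≤ b) (H : ℝ) (h1 : x₁ * b ≤ H) (h2 : H ≤ x₂ * b) :
    (b⁻¹) ^ 6 * (S / 1200) ≤
      layerInteraction lennardJones b H δ 1 - layerInteraction lennardJones b (H - b / 200) δ 1 := by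
  have hb0 : 0 < b := by linarith
  set x := H / b with hx
  have hH : H = x * b := by rw [hx]; field_simp
  have hH' : H - b / 200 = (x - 1 / 200) * b := by rw [hx]; field_simp
  have hx1 : x₁ ≤ x := by rw [hx, le_div_iff₀ hb0]; exact h1
  have hx2 : x ≤ x₂ := by rw [hx, div_le_iff₀ hb0]; exact h2
  rw [hH', hH]
  have key := vp_layer_shrink b (33 / 25) x₁ x₂ (1 / 200) x δ hδ (by linarith) (vp_beta_le b hb)
    (by norm_num) hx₁ hx1 hx2
  refine le_trans ?_ key
  rw [show (b⁻¹) ^ 6 * (S / 1200) = (b⁻¹) ^ 6 / 6 * (1 / 200 * S) by ring]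
  exact mul_le_mul_of_nonneg_left (mul_le_mul_of_nonneg_left hS (by norm_num)) (by positivity)

/-- **Adjacent layers across a HIGH gap** (offset registry `δ ≢ 0 (mod 3)`, `H ∈ [17b/20, 13b/15]`):
`b⁻⁶ · (−0.835/1200) ≤ Φ_δ(H) − Φ_δ(H − b/200)` (`b ≥ 191/200`). [folklore] -/
theorem vp_high_one (b : ℝ) (hb : 191 / 200 ≤ b) (δ : ℤ) (hδ : δ % 3 ≠ 0)
    (H : ℝ) (h1 : 17 / 20 * b ≤ H) (h2 : H ≤ 13 / 15 * b) :
    (b⁻¹) ^ 6 * (-(835 / 1000) / 1200) ≤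
      layerInteraction lennardJones b H δ 1 - layerInteraction lennardJones b (H - b / 200) δ 1 := by
  rw [layerInteraction_eq_ite lennardJones b H δ, layerInteraction_eq_ite lennardJones b (H - b / 200) δ,
    if_neg hδ, if_neg hδ]
  exact vp_shrink_of_box 1 (Or.inr rfl) (17 / 20) (13 / 15) _ (by norm_num) vp_box_high_one b hb H h1 h2

/-- **Layers at distance two across a HIGH gap** (any registry, `H ∈ [33b/20, 26b/15]`):
`b⁻⁶ · (0.428/1200) ≤ Φ_δ(H) − Φ_δ(H − b/200)`. [folklore] -/
theorem vp_high_two (b : ℝ) (hb : 191 / 200 ≤ b) (δ : ℤ)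
    (H : ℝ) (h1 : 33 / 20 * b ≤ H) (h2 : H ≤ 26 / 15 * b) :
    (b⁻¹) ^ 6 * (428 / 1000 / 1200) ≤
      layerInteraction lennardJones b H δ 1 - layerInteraction lennardJones b (H - b / 200) δ 1 := by
  rw [layerInteraction_eq_ite lennardJones b H δ, layerInteraction_eq_ite lennardJones b (H - b / 200) δ]
  split_ifs
  · exact vp_shrink_of_box 0 (Or.inl rfl) (33 / 20) (26 / 15) _ (by norm_num) vp_box_high_two_aligned
      b hb H h1 h2
  · exact vp_shrink_of_box 1 (Or.inr rfl) (33 / 20) (26 / 15) _ (by norm_num) vp_box_high_two_offset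
      b hb H h1 h2

/-- **Layers at distance three across a HIGH gap** (any registry, `H ∈ [49b/20, 13b/5]`):
`b⁻⁶ · (0.056/1200) ≤ Φ_δ(H) − Φ_δ(H − b/200)`. [folklore] -/
theorem vp_high_three (b : ℝ) (hb : 191 / 200 ≤ b) (δ : ℤ)
    (H : ℝ) (h1 : 49 / 20 * b ≤ H) (h2 : H ≤ 13 / 5 * b) :
    (b⁻¹) ^ 6 * (56 / 1000 / 1200) ≤
      layerInteraction lennardJones b H δ 1 - layerInteraction lennardJones b (H - b / 200) δ 1 := by
  rw [layerInteraction_eq_ite lennardJones b H δ, layerInteraction_eq_ite lennardJones b (H - b / 200) δ]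
  split_ifs
  · exact vp_shrink_of_box 0 (Or.inl rfl) (49 / 20) (13 / 5) _ (by norm_num) vp_box_high_three_aligned
      b hb H h1 h2
  · exact vp_shrink_of_box 1 (Or.inr rfl) (49 / 20) (13 / 5) _ (by norm_num) vp_box_high_three_offset
      b hb H h1 h2

/-- **Beyond the potential minimum the layer sums increase with the height**: for `b ∈ [47/50, 1]`,
any registry and `1 ≤ H' ≤ H`, `Φ_δ(H') ≤ Φ_δ(H)`. [folklore] -/
theorem vp_shrink_nonneg (b : ℝ) (hb : 47 / 50 ≤ b) (δ : ℤ) (H H' : ℝ) (hH' : 1 ≤ H')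
    (hle : H' ≤ H) :
    0 ≤ layerInteraction lennardJones b H δ 1 - layerInteraction lennardJones b H' δ 1 := by
  have key : ∀ δ' : ℤ, (δ' = 0 ∨ δ' = 1) →
      layerInteraction lennardJones b H' δ' 1 ≤ layerInteraction lennardJones b H δ' 1 := by
    intro δ' hδ'
    rw [vp_layerInteraction_eq, vp_layerInteraction_eq]
    refine (vp_summable b hb δ' hδ' H' (by linarith)).tsum_le_tsum (fun p => ?_)
      (vp_summable b hb δ' hδ' H (by linarith))
    refine vp_term_mono b (vpP δ' p) H H' (by linarith) hle ?_
    have := vpP_nonneg δ' p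
    nlinarith [mul_nonneg (sq_nonneg b) this]
  rw [layerInteraction_eq_ite lennardJones b H δ, layerInteraction_eq_ite lennardJones b H' δ]
  split_ifs
  · linarith [key 0 (Or.inl rfl)]
  · linarith [key 1 (Or.inr rfl)]

end Summit.AtomisticToContinuum.Crystallization.Theorems.CleanHull

end
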